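import Summits.ValiantsHypothesis.ValiantsHypothesis.Theses.FreeSubtorus
import Literature.Computability.AlgebraicComplexity.GrenetEquivariant
import Literature.Computability.AlgebraicComplexity.LRPencilOfMatrix
import Literature.Computability.AlgebraicComplexity.LandsbergRessayreProofs
import Literature.Computability.AlgebraicComplexity.RankOneDeterminantalExpressionsProofs

/-!
# `FreeSubtorus.OrbitDimensionBound` (stmt-ValiantsHypothesis-16133): symmetry cannot be imposed in place

Negative knowledge for the crux (standing disprover, cycle 1, 2026-08-17).  The crux asks, for
every affine determinantal representation `A` of `per_n` of size `m`, for SOME representation `B`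
of the same size that is equivariant (exact `GL_m × GL_m` lifts) under an admissible subtorus
`T_Λ` (`r ≤ n/2` relations with zero row- and column-sums).  The natural strengthening `B := A`
("every representation is itself admissibly half-torus symmetric") is FALSE, and so are two
further in-place variants, all at the optimal size `(n, m) = (3, 7) = (3, dc(per₃))`:

* `exists_repr_per3_without_homothety_lift`: the Koszul-twisted Grenet matrix `(1+V)·G₇·(1+U)`
  (the witness of `UlrichPaddedNoTightInfinity_refuted`, stmt-5668) is an affine determinantal
  representation of `per₃` admitting NO exact lift of the homothety `x ↦ 2x` (five coefficient
  identities force row `0` of `g` to vanish);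
* `not_inPlaceHomothety`: "every representation of `per_n`, `n ≥ 3`, has exact lifts of all
  homotheties" is false;
* `not_inPlaceModAdmissible`: "every representation is itself `T_Λ`-equivariant for an admissible
  `Λ` of SOME rank" is false (every admissible `T_Λ` contains the homotheties `(d,e) = (c𝟙, 𝟙)`);
* `not_orbitDimensionBound_inPlace`: the crux with `B := A` is false.

Moral for provers of the crux: `B` must differ from `A` by a NON-constant gauge (the witness is
`GL₇(ℂ[x])²`-equivalent to Grenet's fully torus-symmetric `G₇`, but not `GL₇(ℂ)²`-equivalent to any
homothety-symmetric matrix).  Inline statements, no definitions, no new facts.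
-/

noncomputable section

namespace Summit.ValiantsHypothesis.Theorems.OrbitDimensionBoundNegative

open MvPolynomial Matrix
open Literature.Computability.AlgebraicComplexity LRPencil

/-- The coefficient of a variable in the constant `1` vanishes. [folklore] -/
theorem coeff_single_one_one' (v : Fin 3 × Fin 3) :
    coeff (Finsupp.single v 1) (1 : MvPolynomial (Fin 3 × Fin 3) ℂ) = 0 := by
  rw [← C_1, coeff_C, if_neg]
  exact fun h => one_ne_zero (Finsupp.single_eq_zero.1 h.symm)

-- one declaration inspecting all 49 entries of several explicit `7 × 7` matrices at once
set_option maxHeartbeats 1600000 in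
/-- **An optimal-size representation of `per₃` with no exact homothety lift.**  The Koszul-twisted
Grenet matrix `A = (1+V)·G₇·(1+U)` (rows/columns `s, u₀, u₁, u₂, v₀, v₁, v₂`: Grenet's `7 × 7`
matrix of `per₃` with the extra entries `−x₂₀, x₁₀` in column `u₀` and `−x₂₂, x₁₂` in row `v₀`; the
witness of `UlrichPaddedNoTightInfinity_refuted`, stmt-5668) is an affine determinantal
representation of `per₃` (`A · (1+U)⁻¹ · E₁ · E₂` is upper triangular with diagonal
`(per₃, 1, …, 1)`), and if `γ` is the scalar substitution `2` then `A(γ·x) = g A(x) h⁻¹` is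
impossible for `g, h ∈ GL₇(ℂ)`: the constant parts give `g Λ = Λ h`, the linear parts
`g A_v = 2 A_v h`, and the entries `(0,1)` for `v = x₀₀`, `(3,1)` for `x₁₀`, `(0,3)` for `x₂₀`,
`(3,3)` and `(0,j)` of the constant part force `g₀₀ = 2h₁₁ = g₃₃ = h₃₃`, `g₀₀ = 2h₃₃`, `g₀ⱼ = 0`
(`j ≠ 0`) — row `0` of `g` vanishes. [folklore] -/
theorem exists_repr_per3_without_homothety_lift :
    ∃ A : Matrix (Fin 7) (Fin 7) (MvPolynomial (Fin 3 × Fin 3) ℂ),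
      IsAffineDetRepr (perPoly (Fin 3) ℂ) A ∧
      ∀ γ : GL (Fin 3 × Fin 3) ℂ,
        (γ : Matrix (Fin 3 × Fin 3) (Fin 3 × Fin 3) ℂ) = Matrix.diagonal (fun _ => (2 : ℂ)) →
        ¬ ∃ g h : GL (Fin 7) ℂ, Matrix.linSubstEntries γ A =
          (g : Matrix (Fin 7) (Fin 7) ℂ).map C * A *
            ((h⁻¹ : GL (Fin 7) ℂ) : Matrix (Fin 7) (Fin 7) ℂ).map C := by
  obtain ⟨A, hA⟩ : ∃ M : Matrix (Fin 7) (Fin 7) (MvPolynomial (Fin 3 × Fin 3) ℂ), M =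
      !![0, X (0,0), X (1,0), X (2,0), 0, 0, 0;
         0, 1, 0, 0, 0, X (2,1), X (1,1);
         0, -X (2,0), 1, 0, X (2,1), 0, X (0,1);
         0, X (1,0), 0, 1, X (1,1), X (0,1), 0;
         X (0,2), 0, 0, 0, 1, -X (2,2), X (1,2);
         X (1,2), 0, 0, 0, 0, 1, 0;
         X (2,2), 0, 0, 0, 0, 0, 1] := ⟨_, rfl⟩
  -- ### `A` is an affine determinantal representation of `per₃`
  have hrepr : IsAffineDetRepr (perPoly (Fin 3) ℂ) A := by
    obtain ⟨DU, hDU⟩ : ∃ M : Matrix (Fin 7) (Fin 7) (MvPolynomial (Fin 3 × Fin 3) ℂ), M =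
        !![1, 0, 0, 0, 0, 0, 0;
           0, 1, 0, 0, 0, 0, 0;
           0, X (2,0), 1, 0, 0, 0, 0;
           0, -X (1,0), 0, 1, 0, 0, 0;
           0, 0, 0, 0, 1, 0, 0;
           0, 0, 0, 0, 0, 1, 0;
           0, 0, 0, 0, 0, 0, 1] := ⟨_, rfl⟩
    obtain ⟨E1, hE1⟩ : ∃ M : Matrix (Fin 7) (Fin 7) (MvPolynomial (Fin 3 × Fin 3) ℂ), M =
        !![1, 0, 0, 0, 0, 0, 0;
           0, 1, 0, 0, 0, -X (2,1), -X (1,1);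
           0, 0, 1, 0, -X (2,1), 0, -X (0,1);
           0, 0, 0, 1, -X (1,1), -X (0,1), 0;
           0, 0, 0, 0, 1, 0, 0;
           0, 0, 0, 0, 0, 1, 0;
           0, 0, 0, 0, 0, 0, 1] := ⟨_, rfl⟩
    obtain ⟨E2, hE2⟩ : ∃ M : Matrix (Fin 7) (Fin 7) (MvPolynomial (Fin 3 × Fin 3) ℂ), M =
        !![1, 0, 0, 0, 0, 0, 0;
           0, 1, 0, 0, 0, 0, 0;
           0, 0, 1, 0, 0, 0, 0;
           0, 0, 0, 1, 0, 0, 0;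
           -X (0,2), 0, 0, 0, 1, 0, 0;
           -X (1,2), 0, 0, 0, 0, 1, 0;
           -X (2,2), 0, 0, 0, 0, 0, 1] := ⟨_, rfl⟩
    obtain ⟨B1, hB1⟩ : ∃ M : Matrix (Fin 7) (Fin 7) (MvPolynomial (Fin 3 × Fin 3) ℂ), M =
        !![0, X (0,0), X (1,0), X (2,0), 0, 0, 0;
           0, 1, 0, 0, 0, X (2,1), X (1,1);
           0, 0, 1, 0, X (2,1), 0, X (0,1);
           0, 0, 0, 1, X (1,1), X (0,1), 0;
           X (0,2), 0, 0, 0, 1, -X (2,2), X (1,2);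
           X (1,2), 0, 0, 0, 0, 1, 0;
           X (2,2), 0, 0, 0, 0, 0, 1] := ⟨_, rfl⟩
    obtain ⟨B2, hB2⟩ : ∃ M : Matrix (Fin 7) (Fin 7) (MvPolynomial (Fin 3 × Fin 3) ℂ), M =
        !![0, X (0,0), X (1,0), X (2,0), -(X (1,0) * X (2,1) + X (2,0) * X (1,1)),
             -(X (0,0) * X (2,1) + X (2,0) * X (0,1)), -(X (0,0) * X (1,1) + X (1,0) * X (0,1));
           0, 1, 0, 0, 0, 0, 0;
           0, 0, 1, 0, 0, 0, 0;
           0, 0, 0, 1, 0, 0, 0;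
           X (0,2), 0, 0, 0, 1, -X (2,2), X (1,2);
           X (1,2), 0, 0, 0, 0, 1, 0;
           X (2,2), 0, 0, 0, 0, 0, 1] := ⟨_, rfl⟩
    obtain ⟨T, hT⟩ : ∃ M : Matrix (Fin 7) (Fin 7) (MvPolynomial (Fin 3 × Fin 3) ℂ), M =
        !![perPoly (Fin 3) ℂ, X (0,0), X (1,0), X (2,0), -(X (1,0) * X (2,1) + X (2,0) * X (1,1)),
             -(X (0,0) * X (2,1) + X (2,0) * X (0,1)), -(X (0,0) * X (1,1) + X (1,0) * X (0,1));
           0, 1, 0, 0, 0, 0, 0;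
           0, 0, 1, 0, 0, 0, 0;
           0, 0, 0, 1, 0, 0, 0;
           0, 0, 0, 0, 1, -X (2,2), X (1,2);
           0, 0, 0, 0, 0, 1, 0;
           0, 0, 0, 0, 0, 0, 1] := ⟨_, rfl⟩
    have p3 : perPoly (Fin 3) ℂ = X (0,0) * (X (1,1) * X (2,2) + X (2,1) * X (1,2))
        + X (1,0) * (X (0,1) * X (2,2) + X (2,1) * X (0,2))
        + X (2,0) * (X (0,1) * X (1,2) + X (1,1) * X (0,2)) := by
      simp [perPoly, permanent_fin_three, Matrix.mvPolynomialX_apply]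
    -- ONE inspection of the 49 entries: the three products, triangularity, degrees
    have big : ∀ i j : Fin 7,
        ((A * DU) i j = B1 i j ∧ (B1 * E1) i j = B2 i j ∧ (B2 * E2) i j = T i j) ∧
        ((i < j → DU i j = 0) ∧ (j < i → E1 i j = 0) ∧ (i < j → E2 i j = 0) ∧ (j < i → T i j = 0)) ∧
        (A i j).totalDegree ≤ 1 := by
      intro i j
      rw [hA, hDU, hE1, hE2, hB1, hB2, hT, p3]
      fin_cases i <;> fin_cases j <;> refine ⟨⟨?_, ?_, ?_⟩, ⟨?_, ?_, ?_, ?_⟩, ?_⟩ <;>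
        simp [Matrix.mul_apply, Fin.sum_univ_seven, totalDegree_X, totalDegree_neg]
      all_goals ring
    have detA : A.det = perPoly (Fin 3) ℂ := by
      have h1 : A * DU = B1 := Matrix.ext fun i j => (big i j).1.1
      have h2 : B1 * E1 = B2 := Matrix.ext fun i j => (big i j).1.2.1
      have h3 : B2 * E2 = T := Matrix.ext fun i j => (big i j).1.2.2
      have dDU : DU.det = 1 := by
        rw [Matrix.det_of_lowerTriangular DU (fun i j hij => (big i j).2.1.1 hij), Fin.prod_univ_seven, hDU]
        simp
      have dE1 : E1.det = 1 := by
        rw [Matrix.det_of_upperTriangular (M := E1) fun i j hij => (big i j).2.1.2.1 hij,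
          Fin.prod_univ_seven, hE1]
        simp
      have dE2 : E2.det = 1 := by
        rw [Matrix.det_of_lowerTriangular E2 (fun i j hij => (big i j).2.1.2.2.1 hij),
          Fin.prod_univ_seven, hE2]
        simp
      have dT : T.det = perPoly (Fin 3) ℂ := by
        rw [Matrix.det_of_upperTriangular (M := T) fun i j hij => (big i j).2.1.2.2.2 hij,
          Fin.prod_univ_seven, hT]
        simp
      have h := congrArg Matrix.det h3
      rw [← h2, ← h1, Matrix.det_mul, Matrix.det_mul, Matrix.det_mul, dDU, dE1, dE2, dT, mul_one,
        mul_one, mul_one] at h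
      exact h
    exact ⟨fun i j => (big i j).2.2, detA⟩
  refine ⟨A, hrepr, fun γ hγ => ?_⟩
  -- ### no exact lift of the homothety `2`
  rintro ⟨g, h, hgh⟩
  have haff : ∀ r c, (A r c).totalDegree ≤ 1 := hrepr.1
  -- constant parts: `g Λ = Λ h`
  have h0 := mul_constPart_eq_of_linSubstEntries_eq hgh
  -- linear parts: `g A_v = 2 A_v h`
  have hv : ∀ v : Fin 3 × Fin 3, (g : Matrix (Fin 7) (Fin 7) ℂ) * coeffMat A v =
      ((2 : ℂ) • coeffMat A v) * (h : Matrix (Fin 7) (Fin 7) ℂ) := by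
    intro v
    have e := congrArg (fun M => coeffMat M v) hgh
    rw [coeffMat_linSubstEntries _ _ haff, coeffMat_C_mul_mul_C] at e
    have e2 : ∑ i, (γ : Matrix _ _ ℂ) v i • coeffMat A i =
        (2 : ℂ) • coeffMat A v := by
      rw [Finset.sum_eq_single v]
      · rw [hγ, Matrix.diagonal_apply_eq]
      · intro i _ hi
        rw [hγ, Matrix.diagonal_apply_ne _ (Ne.symm hi), zero_smul]
      · simp
    rw [e2] at e
    exact mul_eq_of_eq_mul_mul_inv e
  set G : Matrix (Fin 7) (Fin 7) ℂ := (g : Matrix (Fin 7) (Fin 7) ℂ) with hG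
  set H : Matrix (Fin 7) (Fin 7) ℂ := (h : Matrix (Fin 7) (Fin 7) ℂ) with hH
  -- the five scalar identities
  have e2 : G 0 0 = 2 * H 1 1 := by
    have := congrFun (congrFun (hv (0,0)) 0) 1
    simpa [hA, Matrix.mul_apply, Fin.sum_univ_seven, Finsupp.single_eq_single_iff,
      coeff_single_one_one'] using this
  have e3 : G 3 3 = 2 * H 1 1 := by
    have := congrFun (congrFun (hv (1,0)) 3) 1
    simpa [hA, Matrix.mul_apply, Fin.sum_univ_seven, Finsupp.single_eq_single_iff,
      coeff_single_one_one'] using this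
  have e4 : G 0 0 = 2 * H 3 3 := by
    have := congrFun (congrFun (hv (2,0)) 0) 3
    simpa [hA, Matrix.mul_apply, Fin.sum_univ_seven, Finsupp.single_eq_single_iff,
      coeff_single_one_one'] using this
  have e5 : G 3 3 = H 3 3 := by
    have := congrFun (congrFun h0 3) 3
    simpa [hA, Matrix.mul_apply, Fin.sum_univ_seven] using this
  have e1 : ∀ j : Fin 7, j ≠ 0 → G 0 j = 0 := by
    intro j hj
    have := congrFun (congrFun h0 0) j
    fin_cases j
    · exact absurd rfl hj
    all_goals simpa [hA, Matrix.mul_apply, Fin.sum_univ_seven] using this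
  have g00 : G 0 0 = 0 := by linear_combination 2 * e2 - 2 * e3 - e4 + 2 * e5
  have hrow : ∀ j : Fin 7, G 0 j = 0 := by
    intro j
    by_cases hj : j = 0
    · rw [hj]; exact g00
    · exact e1 j hj
  exact (Matrix.isUnits_det_units g).ne_zero (Matrix.det_eq_zero_of_row_eq_zero 0 hrow)

/-- **In-place homothety symmetry fails**: it is false that every affine determinantal
representation of `per_n` (`n ≥ 3`) itself admits exact lifts of all homotheties `x ↦ c·x`
(witness: the twisted Grenet matrix, `n = 3`, `m = 7 = dc(per₃)`, `c = 2`). [folklore] -/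
theorem not_inPlaceHomothety :
    ¬ ∀ n : ℕ, 3 ≤ n → ∀ (m : ℕ) (A : Matrix (Fin m) (Fin m) (MvPolynomial (Fin n × Fin n) ℂ)),
      IsAffineDetRepr (perPoly (Fin n) ℂ) A →
      ∀ γ : GL (Fin n × Fin n) ℂ, (∃ c : ℂ, c ≠ 0 ∧
        (γ : Matrix (Fin n × Fin n) (Fin n × Fin n) ℂ) = Matrix.diagonal fun _ => c) →
      ∃ g h : GL (Fin m) ℂ, Matrix.linSubstEntries γ A =
        (g : Matrix (Fin m) (Fin m) ℂ).map C * A * ((h⁻¹ : GL (Fin m) ℂ) : Matrix (Fin m) (Fin m) ℂ).map C := by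
  intro hIP
  obtain ⟨A, hA, hno⟩ := exists_repr_per3_without_homothety_lift
  exact hno (Grenet.diagUnit (fun _ : Fin 3 × Fin 3 => (2 : ℂ)) fun _ => two_ne_zero) rfl
    (hIP 3 le_rfl 7 A hA _ ⟨2, two_ne_zero, rfl⟩)

/-- `∏ c^{f k} = c^{Σ f k}` in a commutative group (integer exponents). [folklore] -/
theorem prod_zpow_eq_zpow_sum {G ι : Type*} [CommGroup G] (c : G) (s : Finset ι) (f : ι → ℤ) :
    ∏ k ∈ s, c ^ f k = c ^ (∑ k ∈ s, f k) := by
  classical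
  induction s using Finset.induction_on with
  | empty => simp
  | insert a s ha ih => rw [Finset.prod_insert ha, Finset.sum_insert ha, ih, _root_.zpow_add]

/-- **Every admissible subtorus contains the homothety `x ↦ 2x`** (generator `(d, e) = (2·𝟙, 𝟙)`:
each relation evaluates to `2^{row-sum} = 2⁰ = 1`). [folklore] -/
theorem homothety_two_mem_closure {n r : ℕ} {Λ : Fin r → (Fin n ⊕ Fin n) → ℤ}
    (hΛ : ∀ i, (∑ k, Λ i (Sum.inl k)) = 0 ∧ (∑ l, Λ i (Sum.inr l)) = 0) :
    Grenet.diagUnit (fun _ : Fin n × Fin n => (2 : ℂ)) (fun _ => two_ne_zero) ∈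
      Subgroup.closure {γ : Matrix.GeneralLinearGroup (Fin n × Fin n) ℂ | ∃ d e : Fin n → ℂˣ,
        (∀ i, (∏ k, (d k) ^ (Λ i (Sum.inl k))) * (∏ l, (e l) ^ (Λ i (Sum.inr l))) = 1) ∧
        (γ : Matrix (Fin n × Fin n) (Fin n × Fin n) ℂ) =
          Matrix.diagonal (fun p => (d p.1 : ℂ) * (e p.2 : ℂ))} := by
  refine Subgroup.subset_closure ⟨fun _ => Units.mk0 (2 : ℂ) two_ne_zero, fun _ => 1,
    fun i => ?_, ?_⟩
  · rw [prod_zpow_eq_zpow_sum, prod_zpow_eq_zpow_sum, (hΛ i).1, zpow_zero, _root_.one_zpow,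
      mul_one]
  · rw [Grenet.val_diagUnit]
    congr 1
    funext p
    simp

/-- **In-place symmetry modulo ANY admissible lattice fails**: it is false that every affine
determinantal representation of `per_n` (`n ≥ 3`) is ITSELF `T_Λ`-equivariant for some admissible
`Λ` of some rank `r` — no cap `r ≤ n/2` is needed for the failure (witness: twisted Grenet,
`(n, m) = (3, 7)`; `T_Λ ∋ (x ↦ 2x)`, which does not lift). [folklore] -/
theorem not_inPlaceModAdmissible :
    ¬ ∀ n : ℕ, 3 ≤ n → ∀ (m : ℕ) (A : Matrix (Fin m) (Fin m) (MvPolynomial (Fin n × Fin n) ℂ)),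
      IsAffineDetRepr (perPoly (Fin n) ℂ) A →
      ∃ (r : ℕ) (Λ : Fin r → (Fin n ⊕ Fin n) → ℤ),
        (∀ i, (∑ k, Λ i (Sum.inl k)) = 0 ∧ (∑ l, Λ i (Sum.inr l)) = 0) ∧
        IsEquivariantDetRepr (Subgroup.closure {γ : Matrix.GeneralLinearGroup (Fin n × Fin n) ℂ |
          ∃ d e : Fin n → ℂˣ, (∀ i, (∏ k, (d k) ^ (Λ i (Sum.inl k))) * (∏ l, (e l) ^ (Λ i (Sum.inr l))) = 1) ∧
          (γ : Matrix (Fin n × Fin n) (Fin n × Fin n) ℂ) =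
            Matrix.diagonal (fun p => (d p.1 : ℂ) * (e p.2 : ℂ))}) (perPoly (Fin n) ℂ) A := by
  intro h
  obtain ⟨A, hA, hno⟩ := exists_repr_per3_without_homothety_lift
  obtain ⟨r, Λ, hΛ, hE⟩ := h 3 le_rfl 7 A hA
  exact hno _ rfl (hE.2 _ (homothety_two_mem_closure hΛ))

/-- **The crux with `B := A` is false** (`OrbitDimensionBound` asks for SOME `B`; the in-place
version "every representation is itself admissibly half-torus symmetric, `r ≤ n/2`" fails at
`(n, m) = (3, dc(per₃))`). [folklore] -/
theorem not_orbitDimensionBound_inPlace :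
    ¬ ∀ n : ℕ, 3 ≤ n → ∀ (m : ℕ) (A : Matrix (Fin m) (Fin m) (MvPolynomial (Fin n × Fin n) ℂ)),
      IsAffineDetRepr (perPoly (Fin n) ℂ) A →
      ∃ (r : ℕ) (Λ : Fin r → (Fin n ⊕ Fin n) → ℤ), r ≤ n / 2 ∧
        (∀ i, (∑ k, Λ i (Sum.inl k)) = 0 ∧ (∑ l, Λ i (Sum.inr l)) = 0) ∧
        IsEquivariantDetRepr (Subgroup.closure {γ : Matrix.GeneralLinearGroup (Fin n × Fin n) ℂ |
          ∃ d e : Fin n → ℂˣ, (∀ i, (∏ k, (d k) ^ (Λ i (Sum.inl k))) * (∏ l, (e l) ^ (Λ i (Sum.inr l))) = 1) ∧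
          (γ : Matrix (Fin n × Fin n) (Fin n × Fin n) ℂ) =
            Matrix.diagonal (fun p => (d p.1 : ℂ) * (e p.2 : ℂ))}) (perPoly (Fin n) ℂ) A :=
  fun h => not_inPlaceModAdmissible fun n hn m A hA =>
    let ⟨r, Λ, _, hΛ, hE⟩ := h n hn m A hA
    ⟨r, Λ, hΛ, hE⟩

/-- Sanity: the in-place version does imply the crux BY NAME (so the refuted statement is a
genuine strengthening of `OrbitDimensionBound`, not a sibling). [folklore] -/
theorem orbitDimensionBound_of_inPlace
    (h : ∀ n : ℕ, 3 ≤ n → ∀ (m : ℕ) (A : Matrix (Fin m) (Fin m) (MvPolynomial (Fin n × Fin n) ℂ)),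
      IsAffineDetRepr (perPoly (Fin n) ℂ) A →
      ∃ (r : ℕ) (Λ : Fin r → (Fin n ⊕ Fin n) → ℤ), r ≤ n / 2 ∧
        (∀ i, (∑ k, Λ i (Sum.inl k)) = 0 ∧ (∑ l, Λ i (Sum.inr l)) = 0) ∧
        IsEquivariantDetRepr (Subgroup.closure {γ : Matrix.GeneralLinearGroup (Fin n × Fin n) ℂ |
          ∃ d e : Fin n → ℂˣ, (∀ i, (∏ k, (d k) ^ (Λ i (Sum.inl k))) * (∏ l, (e l) ^ (Λ i (Sum.inr l))) = 1) ∧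
          (γ : Matrix (Fin n × Fin n) (Fin n × Fin n) ℂ) =
            Matrix.diagonal (fun p => (d p.1 : ℂ) * (e p.2 : ℂ))}) (perPoly (Fin n) ℂ) A) :
    Summit.ValiantsHypothesis.ValiantsHypothesis.Theses.FreeSubtorus.OrbitDimensionBound :=
  fun n hn m A hA =>
    let ⟨r, Λ, hr, hΛ, hE⟩ := h n hn m A hA
    ⟨A, r, Λ, hr, hΛ, hE⟩

end Summit.ValiantsHypothesis.Theorems.OrbitDimensionBoundNegative

end
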